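import Literature.MathematicalPhysics.QuantumFieldTheory.Balaban1983to89.Beta.DressedMomentNormalisation
import Literature.MathematicalPhysics.QuantumFieldTheory.Balaban1983to89.Beta.KernelRepresentationSummable

/-!
# Bałaban, *Renormalization group approach to lattice gauge field theories. I* (Comm. Math. Phys. 109 (1987)
# 249–301) — β-function sub-cell: a KERNEL-REPRESENTED affine-reproducing spec with summable response kernel
# satisfies the entrywise hypotheses of the normalisation last mile, hence `IdentityForm` for families
# (composition of `Beta/KernelRepresentationSummable` with `Beta/DressedMomentNormalisation`)

HONEST FRAMING.  This module formalises NO statement printed in [Balaban1987RG1]; it is the [folklore] COMPOSITION of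
two sibling leaves and carries the cite tag for context only.  `Beta/DressedMomentNormalisation` (row BETA-an2 gen 5)
proves the normalisation last mile — from the ENTRYWISE reproduction identities (L0∞)/(L1∞) of a response kernel
`w : EKer d` (hypotheses `hw0`/`hw1`), absolute second moments, and the low moments (T0)/(T1) of a Hessian kernel `T`,
to the decimated second moment of the matrix dressed kernel `Wᵀ T W`, the bond normalisation, and in `d = 4` to
`MarginalTelescoping.IdentityForm` for families (`identityForm_of_kernelFamilies`); its §5 derives `hw0`/`hw1` from an
`AffineReproduction.InfiniteVolumeSpec` whose map `H` is kernel-represented with FINITELY SUPPORTED entries.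
`Beta/KernelRepresentationSummable` (sub-cell B12 gen 12) derives the same `hw0`/`hw1`, in exactly these binder
shapes, from a spec whose `H` is the kernel map `kernelOpSum N w` with INFINITELY EXTENDED entries having absolute
second moments (`lowMomentsSum_of_spec`), and (T0)/(T1) for an infinitely extended matrix family from two lattice
symmetries (`lowMomentsSum_of_symmetries`).  THIS FILE states the compositions once, so that downstream bookkeeping
(the cell's `hid` binder of `Beta/ComposedRoad.oneLoopDrift_of_composedLegInterfaceOn_identity`) can name one theorem:
for every pair of scales `j < k`, a kernel-represented spec at block size `N j k ≠ 0` with `AbsMoment₂` response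
kernel, and Hessian kernels with `AbsMoment₂` entries and (T0)/(T1) — or the two symmetries — give `IdentityForm`
(`identityForm_of_specFamilies`, `identityForm_of_specFamilies_of_symmetries`), with NO finiteness idealisation left
(cell records: AN2 (Y17) caveats (δ)/(ε); BETA-SPEC §7.24 (c)).

WHAT THIS FILE PROVES (all [folklore]; over `ℝ`).
* §1 general `d`: `lowMoments_entry_of_spec` (the pair `hw0`/`hw1` from a kernel-represented spec, restated over
  `EKer d`), `secondMoment_dressedEntry_of_spec` (= `DressedMomentNormalisation.secondMoment_dressedEntry_hasSum_lattice`
  fed with `KernelRepresentationSummable.lowMomentsSum_of_spec`), `bondSecondMoment_of_spec`, and the variants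
  `…_of_symmetries` in which (T0)/(T1) are discharged from backward-difference divergence-freeness and midpoint
  inversion of `T` (`KernelRepresentationSummable.lowMomentsSum_of_symmetries`).
* §2 `d = 4`: `entryHyps_of_spec` / `entryHyps_of_spec_of_symmetries` (`DressedMomentNormalisation.EntryHyps N w T`),
  `coarseTensor_eq_m2Tensor_of_spec` (the coarse bond tensor IS `M2(T)` at every fixed block size).
* §3 families: `identityForm_of_specFamilies`, its `hident` variant `identityForm_of_specFamilies'`, and
  `identityForm_of_specFamilies_of_symmetries` — specs `S j k hjk : InfiniteVolumeSpec 4 (Nf j k)` are taken only for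
  `j < k` (no vacuous instance at an unused pair is demanded).

WHAT THIS FILE DOES NOT DO.  It constructs NO instance of `InfiniteVolumeSpec` and does not assert that Bałaban's
minimiser is kernel-represented by `kernelOpSum N w` with `AbsMoment₂` columns: `S`, `hrep : S.H = kernelOpSum N w` and
`AbsMoment₂ (w κ l)` are HYPOTHESES (the cell's residual (O1′) — a located kernel programme, not a theorem today);
whether the actual Hessian kernel has the two symmetries / (T0)/(T1) is the cell's reading (D-a)/(I4′), assumed here;
the identification `hident` of the flow coefficients with the read-out of the `M2` tensors is not touched; nothing is
said about (H-aff)_k, (Q-aff), (I2)/(I4)/(I5)/(I6) or the sign of any coefficient.  No cited facts are used; the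
manuscript under audit is not used for anything.

Version v1 (2026-08-19, b2b-balaban-b12-g12).  value = kernel packaging leaf, NOT summit progress; NOT continuum, NOT Clay.
-/

namespace Literature.MathematicalPhysics.QuantumFieldTheory.Balaban1983to89.Beta.KernelSpecIdentityForm

open AffineReproduction (InfiniteVolumeSpec)
open DecimatedMomentSummable (ConstReproSum LinReproSum AbsMoment₂)
open DressedMomentNormalisation (EKer dressedEntry EntryHyps coarseTensor m2Tensor
  secondMoment_dressedEntry_hasSum_lattice bondSecondMoment_hasSum coarseTensor_eq_m2Tensor
  identityForm_of_kernelFamilies identityForm_of_kernelFamilies')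
open KernelRepresentationSummable (kernelOpSum lowMomentsSum_of_spec lowMomentsSum_of_symmetries)

variable {d N : ℕ}

/-! ## §1 General dimension: the entrywise hypotheses and the decimated second moment from a kernel-represented spec -/

/-- The backward-difference DIVERGENCE-FREENESS of a matrix kernel in its first index:
`Σ_μ (T μ ν x − T μ ν (x − e_μ)) = 0`. [folklore] -/
def DivFree (T : EKer d) : Prop :=
  ∀ (ν : Fin d) (x : Fin d → ℤ), ∑ μ, (T μ ν x - T μ ν (x - Pi.single μ 1)) = 0

/-- The MIDPOINT INVERSION symmetry of a matrix kernel: `T μ ν (e_ν − e_μ − y) = T μ ν y`. [folklore] -/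
def MidInv (T : EKer d) : Prop :=
  ∀ (μ ν : Fin d) (y : Fin d → ℤ), T μ ν ((Pi.single ν 1 - Pi.single μ 1) - y) = T μ ν y

/-- (T0)/(T1) for every entry of an `AbsMoment₂` matrix kernel with the two symmetries, in the binder shapes of
`DressedMomentNormalisation`. [folklore] -/
theorem lowMoments_T_of_symmetries (T : EKer d) (hTA : ∀ c e, AbsMoment₂ (T c e)) (hdiv : DivFree T)
    (hinv : MidInv T) :
    (∀ c e, HasSum (T c e) 0) ∧ ∀ c e (μ : Fin d), HasSum (fun t : Fin d → ℤ => t μ • T c e t) 0 := by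
  obtain ⟨h0, h1⟩ := lowMomentsSum_of_symmetries T hTA hdiv hinv
  exact ⟨h0, fun c e μ => h1 μ c e⟩

/-- The entrywise reproduction identities (L0∞)/(L1∞) — the binders `hw0`/`hw1` of
`DressedMomentNormalisation.secondMoment_dressedEntry_hasSum_lattice` — for the response kernel of a KERNEL-REPRESENTED
affine-reproducing spec with `AbsMoment₂` entries. [folklore] -/
theorem lowMoments_entry_of_spec [NeZero N] (S : InfiniteVolumeSpec d N) (w : EKer d)
    (hwA : ∀ κ l, AbsMoment₂ (w κ l)) (hrep : S.H = kernelOpSum N w) :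
    (∀ κ l : Fin d, ConstReproSum N (w κ l) (if κ = l then (((N : ℝ) ^ (d + 1))⁻¹) else 0))
      ∧ ∀ κ l : Fin d, ∃ C : Fin d → ℝ, LinReproSum N (w κ l) C :=
  lowMomentsSum_of_spec S w hwA hrep

/-- **THE DECIMATED SECOND MOMENT OF THE MATRIX DRESSED KERNEL FROM A KERNEL-REPRESENTED SPEC** (general `d`):
for `S : InfiniteVolumeSpec d N` with `S.H = kernelOpSum N w`, `AbsMoment₂` response and Hessian kernels and (T0)/(T1),
the `N•ℤ^d`-decimated second moment with weight `(N z)_κ (N z)_λ` of the `(a,b)` entry of `Wᵀ T W` has the sum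
`N^{−(d+2)} · Σ'_t t_κ t_λ T a b t`. [folklore] -/
theorem secondMoment_dressedEntry_of_spec [NeZero N] (S : InfiniteVolumeSpec d N) (w T : EKer d)
    (hwA : ∀ κ l, AbsMoment₂ (w κ l)) (hrep : S.H = kernelOpSum N w) (hTA : ∀ c e, AbsMoment₂ (T c e))
    (hT0 : ∀ c e, HasSum (T c e) 0) (hT1 : ∀ c e (μ : Fin d), HasSum (fun t : Fin d → ℤ => t μ • T c e t) 0)
    (κ lam a b : Fin d) :
    HasSum (fun z : Fin d → ℤ => ((N : ℤ) ^ 2 * (z κ * z lam)) • dressedEntry w T ((N : ℤ) • z) a b)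
      ((((N : ℝ) ^ (d + 2))⁻¹) * ∑' t : Fin d → ℤ, (t κ * t lam) • T a b t) :=
  secondMoment_dressedEntry_hasSum_lattice (Nat.pos_of_ne_zero (NeZero.ne N)) w T
    (lowMomentsSum_of_spec S w hwA hrep).1 (lowMomentsSum_of_spec S w hwA hrep).2 hwA hTA hT0 hT1 κ lam a b

/-- … with (T0)/(T1) discharged from the two symmetries of `T`. [folklore] -/
theorem secondMoment_dressedEntry_of_spec_of_symmetries [NeZero N] (S : InfiniteVolumeSpec d N) (w T : EKer d)
    (hwA : ∀ κ l, AbsMoment₂ (w κ l)) (hrep : S.H = kernelOpSum N w) (hTA : ∀ c e, AbsMoment₂ (T c e))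
    (hdiv : DivFree T) (hinv : MidInv T) (κ lam a b : Fin d) :
    HasSum (fun z : Fin d → ℤ => ((N : ℤ) ^ 2 * (z κ * z lam)) • dressedEntry w T ((N : ℤ) • z) a b)
      ((((N : ℝ) ^ (d + 2))⁻¹) * ∑' t : Fin d → ℤ, (t κ * t lam) • T a b t) :=
  secondMoment_dressedEntry_of_spec S w T hwA hrep hTA (lowMoments_T_of_symmetries T hTA hdiv hinv).1
    (lowMoments_T_of_symmetries T hTA hdiv hinv).2 κ lam a b

/-- BOND NORMALISATION from a kernel-represented spec (general `d`): the coarse bond second moment in coarse units has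
the sum `(N^d / N^4) · Σ'_t t_κ t_λ T a b t`. [folklore] -/
theorem bondSecondMoment_of_spec [NeZero N] (S : InfiniteVolumeSpec d N) (w T : EKer d)
    (hwA : ∀ κ l, AbsMoment₂ (w κ l)) (hrep : S.H = kernelOpSum N w) (hTA : ∀ c e, AbsMoment₂ (T c e))
    (hT0 : ∀ c e, HasSum (T c e) 0) (hT1 : ∀ c e (μ : Fin d), HasSum (fun t : Fin d → ℤ => t μ • T c e t) 0)
    (κ lam a b : Fin d) :
    HasSum (fun z : Fin d → ℤ => ((z κ * z lam : ℤ) : ℝ) * ((N : ℝ) ^ (2 * d) * dressedEntry w T ((N : ℤ) • z) a b))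
      ((N : ℝ) ^ d / (N : ℝ) ^ 4 * ∑' t : Fin d → ℤ, (t κ * t lam) • T a b t) :=
  bondSecondMoment_hasSum (Nat.pos_of_ne_zero (NeZero.ne N)) w T
    (lowMomentsSum_of_spec S w hwA hrep).1 (lowMomentsSum_of_spec S w hwA hrep).2 hwA hTA hT0 hT1 κ lam a b

/-! ## §2 `d = 4`: the packaged entry hypotheses and the coarse bond tensor -/

/-- **`EntryHyps` FROM A KERNEL-REPRESENTED SPEC** (`d = 4`). [folklore] -/
theorem entryHyps_of_spec [NeZero N] (S : InfiniteVolumeSpec 4 N) (w T : EKer 4)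
    (hwA : ∀ κ l, AbsMoment₂ (w κ l)) (hrep : S.H = kernelOpSum N w) (hTA : ∀ c e, AbsMoment₂ (T c e))
    (hT0 : ∀ c e, HasSum (T c e) 0) (hT1 : ∀ c e (μ : Fin 4), HasSum (fun t : Fin 4 → ℤ => t μ • T c e t) 0) :
    EntryHyps N w T where
  pos := Nat.pos_of_ne_zero (NeZero.ne N)
  const := (lowMomentsSum_of_spec S w hwA hrep).1
  lin := (lowMomentsSum_of_spec S w hwA hrep).2
  absW := hwA
  absT := hTA
  T0 := hT0
  T1 := hT1

/-- … with (T0)/(T1) discharged from the two symmetries of `T`. [folklore] -/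
theorem entryHyps_of_spec_of_symmetries [NeZero N] (S : InfiniteVolumeSpec 4 N) (w T : EKer 4)
    (hwA : ∀ κ l, AbsMoment₂ (w κ l)) (hrep : S.H = kernelOpSum N w) (hTA : ∀ c e, AbsMoment₂ (T c e))
    (hdiv : DivFree T) (hinv : MidInv T) : EntryHyps N w T :=
  entryHyps_of_spec S w T hwA hrep hTA (lowMoments_T_of_symmetries T hTA hdiv hinv).1
    (lowMoments_T_of_symmetries T hTA hdiv hinv).2

/-- In `d = 4` the coarse bond tensor of a kernel-represented spec IS the second-moment tensor of `T`, at every fixed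
block size. [folklore] -/
theorem coarseTensor_eq_m2Tensor_of_spec [NeZero N] (S : InfiniteVolumeSpec 4 N) (w T : EKer 4)
    (hwA : ∀ κ l, AbsMoment₂ (w κ l)) (hrep : S.H = kernelOpSum N w) (hTA : ∀ c e, AbsMoment₂ (T c e))
    (hT0 : ∀ c e, HasSum (T c e) 0) (hT1 : ∀ c e (μ : Fin 4), HasSum (fun t : Fin 4 → ℤ => t μ • T c e t) 0) :
    coarseTensor N w T = m2Tensor T :=
  coarseTensor_eq_m2Tensor (entryHyps_of_spec S w T hwA hrep hTA hT0 hT1)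

/-! ## §3 Families of scales: `IdentityForm` from kernel-represented specs -/

/-- **`IdentityForm` FROM KERNEL-REPRESENTED SPECS.**  Block sizes `Nf j k ≠ 0`, specs `S j k hjk` only for `j < k`,
response kernels `w j k` with `AbsMoment₂` entries representing `(S j k hjk).H`, Hessian kernels `T j` with `AbsMoment₂`
entries and (T0)/(T1); ANY read-out `F` of the second-moment tensor.  Then `μC j k := F (coarseTensor …)` and
`β0 j := F (m2Tensor (T j))` satisfy `MarginalTelescoping.IdentityForm μC β0`. [folklore] -/
theorem identityForm_of_specFamilies (Nf : ℕ → ℕ → ℕ) (hN : ∀ j k, j < k → Nf j k ≠ 0)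
    (S : ∀ j k : ℕ, j < k → InfiniteVolumeSpec 4 (Nf j k)) (w : ℕ → ℕ → EKer 4) (T : ℕ → EKer 4)
    (hwA : ∀ j k, j < k → ∀ κ l, AbsMoment₂ (w j k κ l))
    (hrep : ∀ j k (hjk : j < k), (S j k hjk).H = kernelOpSum (Nf j k) (w j k))
    (hTA : ∀ j c e, AbsMoment₂ (T j c e)) (hT0 : ∀ j c e, HasSum (T j c e) 0)
    (hT1 : ∀ j c e (μ : Fin 4), HasSum (fun t : Fin 4 → ℤ => t μ • T j c e t) 0)
    (F : (Fin 4 → Fin 4 → Fin 4 → Fin 4 → ℝ) → ℝ) :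
    MarginalTelescoping.IdentityForm (fun j k => F (coarseTensor (Nf j k) (w j k) (T j)))
      (fun j => F (m2Tensor (T j))) :=
  identityForm_of_kernelFamilies Nf w T (fun j k hjk => by
    haveI : NeZero (Nf j k) := ⟨hN j k hjk⟩
    exact entryHyps_of_spec (S j k hjk) (w j k) (T j) (hwA j k hjk) (hrep j k hjk) (hTA j) (hT0 j) (hT1 j)) F

/-- … hence for any target sequence `β0` IDENTIFIED with the read-out of the `M2` tensors (the `hident` side, a
hypothesis) the composed coefficients of kernel-represented specs satisfy `IdentityForm μC β0`. [folklore] -/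
theorem identityForm_of_specFamilies' (Nf : ℕ → ℕ → ℕ) (hN : ∀ j k, j < k → Nf j k ≠ 0)
    (S : ∀ j k : ℕ, j < k → InfiniteVolumeSpec 4 (Nf j k)) (w : ℕ → ℕ → EKer 4) (T : ℕ → EKer 4)
    (hwA : ∀ j k, j < k → ∀ κ l, AbsMoment₂ (w j k κ l))
    (hrep : ∀ j k (hjk : j < k), (S j k hjk).H = kernelOpSum (Nf j k) (w j k))
    (hTA : ∀ j c e, AbsMoment₂ (T j c e)) (hT0 : ∀ j c e, HasSum (T j c e) 0)
    (hT1 : ∀ j c e (μ : Fin 4), HasSum (fun t : Fin 4 → ℤ => t μ • T j c e t) 0)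
    (F : (Fin 4 → Fin 4 → Fin 4 → Fin 4 → ℝ) → ℝ) {β0 : ℕ → ℝ} (hβ : ∀ j, β0 j = F (m2Tensor (T j))) :
    MarginalTelescoping.IdentityForm (fun j k => F (coarseTensor (Nf j k) (w j k) (T j))) β0 :=
  identityForm_of_kernelFamilies' Nf w T (fun j k hjk => by
    haveI : NeZero (Nf j k) := ⟨hN j k hjk⟩
    exact entryHyps_of_spec (S j k hjk) (w j k) (T j) (hwA j k hjk) (hrep j k hjk) (hTA j) (hT0 j) (hT1 j)) F hβ

/-- **`IdentityForm` FROM KERNEL-REPRESENTED SPECS AND SYMMETRIC HESSIAN KERNELS**: as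
`identityForm_of_specFamilies`, with (T0)/(T1) of every `T j` discharged from divergence-freeness and midpoint
inversion. [folklore] -/
theorem identityForm_of_specFamilies_of_symmetries (Nf : ℕ → ℕ → ℕ) (hN : ∀ j k, j < k → Nf j k ≠ 0)
    (S : ∀ j k : ℕ, j < k → InfiniteVolumeSpec 4 (Nf j k)) (w : ℕ → ℕ → EKer 4) (T : ℕ → EKer 4)
    (hwA : ∀ j k, j < k → ∀ κ l, AbsMoment₂ (w j k κ l))
    (hrep : ∀ j k (hjk : j < k), (S j k hjk).H = kernelOpSum (Nf j k) (w j k))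
    (hTA : ∀ j c e, AbsMoment₂ (T j c e)) (hdiv : ∀ j, DivFree (T j)) (hinv : ∀ j, MidInv (T j))
    (F : (Fin 4 → Fin 4 → Fin 4 → Fin 4 → ℝ) → ℝ) :
    MarginalTelescoping.IdentityForm (fun j k => F (coarseTensor (Nf j k) (w j k) (T j)))
      (fun j => F (m2Tensor (T j))) :=
  identityForm_of_specFamilies Nf hN S w T hwA hrep hTA
    (fun j => (lowMoments_T_of_symmetries (T j) (hTA j) (hdiv j) (hinv j)).1)
    (fun j => (lowMoments_T_of_symmetries (T j) (hTA j) (hdiv j) (hinv j)).2) F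

end Literature.MathematicalPhysics.QuantumFieldTheory.Balaban1983to89.Beta.KernelSpecIdentityForm
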